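import Literature.NumberTheory.EllipticCurves.NeronModelBaseChangeDescent
import Literature.NumberTheory.EllipticCurves.NeronModelProperOfGoodReduction
import Literature.AlgebraicGeometry.Motives.IntegralModelBaseChange
import Literature.RingTheory.DiscreteValuationRing.StrictlyLocalExtension
import Literature.AlgebraicGeometry.Motives.GoodReductionZariskiProofs
import Literature.AlgebraicGeometry.Motives.AbelianVarietyProjectiveChart
import Mathlib.RingTheory.DedekindDomain.Dvr
import Mathlib.RingTheory.Henselian
import Mathlib.RingTheory.AdicCompletion.Basic
import Mathlib.FieldTheory.IsAlgClosed.Basic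
import HarnessLib

/-!
# Koizumi's theorem at number-field places from Koizumi over strictly local bases (road W, junction)
# (Koizumi 1960; Bosch–Lütkebohmert–Raynaud §1.2 Prop. 6/8, §6.5 Cor. 3)

Topic `Literature/NumberTheory/DiophantineGeometry`, namespace `Literature.NumberTheory.DiophantineGeometry`.
THEOREMS ONLY (no definition, no named fact, no `sorry`).  Cell `hodgecm-mathlib` (D-0151), fan B-III (T1) road W,
crux workfile `Cruxes/H21/Lines/r0_koizumi.lean` (B-plan1 v1 a423ff41), registered stub
**`stub_W4_koizumi_descends : KoizumiStrictlyLocal → StrictlyLocalCover → Koizumi`** (lead B-p12, B-plan1 ruling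
2026-08-28T11:52:32Z (c)).  Banked leaf toward road W (r₀); no floor change.

## §1 Geometric irreducibility of the total space of a smooth proper model

`KoizumiStrictlyLocal` (v1 a423ff41, B-p18 rider) asks for `GeometricallyIrreducible 𝒳′.total.hom` of the model
upstairs.  At a number-field place this holds for every smooth proper model `𝒳` over `𝓞_{K,v}` of a smooth projective
geometrically irreducible `X / K` (`IntegralModel.geometricallyIrreducible_total_hom`): a morphism to the spectrum of
the discrete valuation ring `𝓞_{K,v}` is geometrically irreducible as soon as its two fibres are — the generic fibre
`𝒳_K ≅ X` (`IntegralModel.isIntegral_genericFibre`) and the reduction `𝒳 ×_{𝓞_{K,v}} κ(v)`, geometrically irreducible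
by Zariski's connectedness theorem (★ `IntegralModel.geometricallyIrreducible_reductionAt_holds`, Stacks 0E0N/056T) —
because every `Spec L → Spec 𝓞_{K,v}`, `L` a field, factors through `Spec K` or through `Spec κ(v)`; and it is stable
under the base change of models (★ `IntegralModel.geometricallyIrreducible_baseChange_total`).

## §2 The junction `koizumi_of_koizumiStrictlyLocal` (= `stub_W4_koizumi_descends`, texts of v1 a423ff41 verbatim)

IF (Koizumi over strictly local bases) for every complete discrete valuation ring `R′` with algebraically closed
residue field and fraction field `K′`, every abelian variety `A′ / K′` and every integral model `𝒳′` of `A′.X` over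
`R′` with geometrically irreducible fibres that is smooth of relative dimension `dim A′` and proper, `𝒳′` carries an
`R′`-group structure whose generic identification is a homomorphism — AND (strictly local cover, B-p03's head) every
discrete valuation ring `R` has an injective, faithfully flat, unramified extension `R → R′` to such an `R′` — THEN
(Koizumi at number-field places, B-p19's text) every smooth proper integral model `𝒳` over `𝓞_{K,v}` of the variety
underlying an abelian variety `A` over a number field `K` carries a group-scheme structure making it an
abelian-scheme model of `A` at `v`.  PROOF (the cut of 11:40:38Z — descend the NÉRON MAPPING PROPERTY, not the group
law): base-change the model along the cover (A-p04 ★ `IntegralModel.baseChangeAbelianVariety`), supply the geometric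
irreducibility upstairs from §1, obtain an `R′`-group structure from the first hypothesis, and conclude by B-p05's ★
«Koizumi by descent» (`isSchematicNeronModel_of_grpObj_baseChange`: Weil extension upstairs + fpqc descent of the
Néron extension property, ★ `openExtension_of_faithfullyFlat`) and BLR 1.2/6–1.2/8
(★ `IsSchematicNeronModel.exists_isAbelianSchemeModel`).  The junction assembly is adapted (with credit) from B-p05's
draft `KoizumiDescent` f9c956b6 written against the earlier v1 texts.

## References
* S. Koizumi, *On specialization of the Albanese and Picard varieties*, Mem. Coll. Sci. Univ. Kyoto A 32 (1960),
  Thm. p. 377. [Koizumi1960]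
* S. Bosch, W. Lütkebohmert, M. Raynaud, *Néron Models*, Springer 1990, §1.2 Prop. 6, Prop. 8; §6.5 Cor. 3.
  [BLRNeronModels1990]
* The Stacks Project, Tags 0E0N, 056T, 038H (fibres over a discrete valuation ring). [StacksProject]
-/

noncomputable section

open CategoryTheory CategoryTheory.Limits AlgebraicGeometry IsDedekindDomain IsDedekindDomain.HeightOneSpectrum
open scoped NumberField

namespace Literature.AlgebraicGeometry.Motives

namespace IntegralModel

variable {K : Type} [Field K] [NumberField K] {v : HeightOneSpectrum (𝓞 K)} {X : SchemeOver K}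
  (𝒳 : IntegralModel (valuationSubringAtPrime K v) K X)

/-- A ring map out of the discrete valuation ring `𝓞_{K,v}` into a field is either injective or kills the maximal
ideal (its kernel is a prime ideal of a one-dimensional local domain). [folklore] -/
private theorem injective_or_maximalIdeal_le_ker {L : Type} [Field L]
    (ψ : valuationSubringAtPrime K v →+* L) :
    Function.Injective ψ ∨ IsLocalRing.maximalIdeal (valuationSubringAtPrime K v) ≤ RingHom.ker ψ := by
  by_cases h : RingHom.ker ψ = ⊥
  · exact Or.inl ((RingHom.injective_iff_ker_eq_bot ψ).mpr h)
  · right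
    haveI : IsDiscreteValuationRing (valuationSubringAtPrime K v) :=
      IsLocalization.AtPrime.isDiscreteValuationRing_of_dedekind_domain (𝓞 K) v.ne_bot _
    haveI : (RingHom.ker ψ).IsPrime := RingHom.ker_isPrime ψ
    have hmax : (RingHom.ker ψ).IsMaximal := Ideal.IsPrime.isMaximal inferInstance h
    exact (IsLocalRing.eq_maximalIdeal hmax).ge

/-- **The total space of a smooth proper model over `𝓞_{K,v}` of a smooth projective geometrically irreducible
`X / K` has geometrically irreducible fibres** (`GeometricallyIrreducible 𝒳.total.hom`, all fibres, Mathlib's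
`geometrically IrreducibleSpace`): a morphism `Spec L → Spec 𝓞_{K,v}` from the spectrum of a field factors through the
generic point `Spec K` (then the fibre product is a base change of the generic fibre `𝒳_K ≅ X`, geometrically
irreducible — `isIntegral_genericFibre`) or through the closed point `Spec κ(v)` (then it is a base change of the
reduction `𝒳 ×_{𝓞_{K,v}} κ(v)`, geometrically irreducible by Zariski's connectedness theorem —
`geometricallyIrreducible_reductionAt_holds`).  This is the hypothesis `[GeometricallyIrreducible 𝒳′.total.hom]` of
`KoizumiStrictlyLocal` at number-field places, before base change.
[cite: StacksProject, Tags 0E0N and 056T] [cite: SerreTate1968, §1] -/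
theorem geometricallyIrreducible_total_hom {n : ℕ} (hX : IsSmoothProjective n X) (h : 𝒳.IsSmoothProper n) :
    GeometricallyIrreducible 𝒳.total.hom := by
  rw [geometricallyIrreducible_iff]
  intro L _ y Z fst snd hZ
  -- the ring map `ψ : 𝓞_{K,v} → L` underlying `y`
  obtain ⟨ψ', hψ'⟩ : ∃ ψ' : CommRingCat.of (valuationSubringAtPrime K v) ⟶ CommRingCat.of L, Spec.map ψ' = y :=
    ⟨Spec.preimage y, Spec.map_preimage y⟩
  let ψ : valuationSubringAtPrime K v →+* L := ψ'.hom
  have hy : y = Spec.map (CommRingCat.ofHom ψ) := by rw [← hψ']; rfl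
  rcases injective_or_maximalIdeal_le_ker (K := K) (v := v) ψ with hinj | hker
  · -- `y` factors through the generic point: `Z` is a base change of the generic fibre `𝒳_K`
    let ψK : K →+* L := IsFractionRing.lift hinj
    have hψK : ψK.comp (algebraMap (valuationSubringAtPrime K v) K) = ψ :=
      RingHom.ext fun x => IsFractionRing.lift_algebraMap hinj x
    have hyf : y = Spec.map (CommRingCat.ofHom ψK) ≫
        Spec.map (CommRingCat.ofHom (algebraMap (valuationSubringAtPrime K v) K)) := by
      rw [hy, ← Spec.map_comp, ← CommRingCat.ofHom_comp, hψK]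
    haveI hgi := (𝒳.isIntegral_genericFibre hX h).2
    -- `Z → 𝒳_K`, and `Z = 𝒳_K ×_{Spec K} Spec L` (pasting)
    have hsq := IsPullback.of_hasPullback 𝒳.total.hom
      (Spec.map (CommRingCat.ofHom (algebraMap (valuationSubringAtPrime K v) K)))
    have w : fst ≫ 𝒳.total.hom = (snd ≫ Spec.map (CommRingCat.ofHom ψK)) ≫
        Spec.map (CommRingCat.ofHom (algebraMap (valuationSubringAtPrime K v) K)) := by
      rw [hZ.w, hyf, Category.assoc]
    have hs : IsPullback (hsq.lift fst _ w ≫ pullback.fst _ _) snd 𝒳.total.hom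
        (Spec.map (CommRingCat.ofHom ψK) ≫
          Spec.map (CommRingCat.ofHom (algebraMap (valuationSubringAtPrime K v) K))) := by
      rw [IsPullback.lift_fst, ← hyf]
      exact hZ
    have hP := IsPullback.of_right hs (hsq.lift_snd _ _ _) hsq
    exact (geometricallyIrreducible_iff _).mp hgi (Spec.map (CommRingCat.ofHom ψK)) _ _ hP
  · -- `y` factors through the closed point: `Z` is a base change of the reduction `𝒳 ×_{𝓞_{K,v}} κ(v)`
    have hkerle : RingHom.ker (residueAt v) ≤ RingHom.ker ψ := by
      intro x hx
      apply hker
      have h0 : residueFieldEquiv v (IsLocalRing.residue _ x) = 0 := RingHom.mem_ker.mp hx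
      exact (IsLocalRing.residue_eq_zero_iff _).mp ((residueFieldEquiv v).map_eq_zero_iff.mp h0)
    let ψκ : v.asIdeal.ResidueField →+* L :=
      (residueAt v).liftOfSurjective (residueAt_surjective v) ⟨ψ, hkerle⟩
    have hψκ : ψκ.comp (residueAt v) = ψ :=
      (residueAt v).liftOfSurjective_comp (residueAt_surjective v) ⟨ψ, hkerle⟩
    have hyf : y = Spec.map (CommRingCat.ofHom ψκ) ≫ Spec.map (CommRingCat.ofHom (residueAt v)) := by
      rw [hy, ← Spec.map_comp, ← CommRingCat.ofHom_comp, hψκ]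
    haveI hgi : GeometricallyIrreducible
        (pullback.snd 𝒳.total.hom (Spec.map (CommRingCat.ofHom (residueAt v)))) :=
      𝒳.geometricallyIrreducible_reductionAt_holds hX h
    have hsq := IsPullback.of_hasPullback 𝒳.total.hom (Spec.map (CommRingCat.ofHom (residueAt v)))
    have w : fst ≫ 𝒳.total.hom = (snd ≫ Spec.map (CommRingCat.ofHom ψκ)) ≫
        Spec.map (CommRingCat.ofHom (residueAt v)) := by
      rw [hZ.w, hyf, Category.assoc]
    have hs : IsPullback (hsq.lift fst _ w ≫ pullback.fst _ _) snd 𝒳.total.hom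
        (Spec.map (CommRingCat.ofHom ψκ) ≫ Spec.map (CommRingCat.ofHom (residueAt v))) := by
      rw [IsPullback.lift_fst, ← hyf]
      exact hZ
    have hP := IsPullback.of_right hs (hsq.lift_snd _ _ _) hsq
    exact (geometricallyIrreducible_iff _).mp hgi (Spec.map (CommRingCat.ofHom ψκ)) _ _ hP

/-- The geometric irreducibility of the fibres of a smooth proper model over `𝓞_{K,v}` of (the variety underlying)
an abelian variety `A / K` (`A.X` is smooth projective and geometrically integral, ★ `AbelianVariety.isSmoothProjective_holds`).
[cite: StacksProject, Tags 0E0N and 056T] [cite: SerreTate1968, §1] -/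
theorem geometricallyIrreducible_total_hom_abelianVariety {A : AbelianVariety K}
    (𝒳 : IntegralModel (valuationSubringAtPrime K v) K A.X) (h : 𝒳.IsSmoothProper A.dim) :
    GeometricallyIrreducible 𝒳.total.hom :=
  𝒳.geometricallyIrreducible_total_hom AbelianVariety.isSmoothProjective_holds h

end IntegralModel

end Literature.AlgebraicGeometry.Motives

namespace Literature.NumberTheory.DiophantineGeometry

open Literature.AlgebraicGeometry.Motives Literature.NumberTheory.EllipticCurves
open scoped MonObj CategoryTheory.Obj

/-- **Koizumi at number-field places from Koizumi over complete strictly local bases and the strictly-local cover**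
— the registered stub `stub_W4_koizumi_descends : KoizumiStrictlyLocal → StrictlyLocalCover → Koizumi` of the road-W
crux workfile `r0_koizumi` (v1 a423ff41, cell `hodgecm-mathlib`), with the three `Prop` bodies verbatim (the crux
workfile is not importable from `Literature/`; the planner points the stub at this theorem by name).  Proof: base-change
the model along the cover (`IntegralModel.baseChangeAbelianVariety`; geometric irreducibility upstairs from
`IntegralModel.geometricallyIrreducible_total_hom_abelianVariety` + `geometricallyIrreducible_baseChange_total`), obtain an
`R′`-group structure on `𝒳 ⊗ R′` from the first hypothesis, conclude by «Koizumi by descent»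
(`isSchematicNeronModel_of_grpObj_baseChange`) and BLR 1.2/6–1.2/8 (`IsSchematicNeronModel.exists_isAbelianSchemeModel`).
Only the EXISTENCE of the group structure upstairs is used; the completeness / algebraic-closedness / unramifiedness
clauses of the cover are passed to the first hypothesis only.
[cite: Koizumi1960, Thm. p. 377] [cite: BLRNeronModels1990, §1.2 Prop. 6, Prop. 8 and §6.5 Cor. 3]
[cite: MumfordFogartyKirwan1994, Ch. 6 §3, proof of Thm. 6.14, step 3] -/
theorem koizumi_of_koizumiStrictlyLocal_of_strictlyLocalCover
    (hKSL : ∀ (R' : Type) [CommRing R'] [IsDomain R'] [IsDiscreteValuationRing R'] [HenselianLocalRing R']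
      [IsAdicComplete (IsLocalRing.maximalIdeal R') R'], IsAlgClosed (IsLocalRing.ResidueField R') →
      ∀ (K' : Type) [Field K'] [Algebra R' K'] [IsFractionRing R' K'] (A' : AbelianVariety K')
        (𝒳' : IntegralModel R' K' A'.X) [GeometricallyIrreducible 𝒳'.total.hom], 𝒳'.IsSmoothProper A'.dim →
        ∃ _ : GrpObj 𝒳'.total, IsMonHom (M := (genericFibre R' K').obj 𝒳'.total) (N := A'.X) 𝒳'.genericIso.hom)
    (h5 : ∀ (R : Type) [CommRing R] [IsDomain R] [IsDiscreteValuationRing R],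
      ∃ (R' : Type) (_ : CommRing R') (_ : IsDomain R') (_ : IsDiscreteValuationRing R') (_ : Algebra R R'),
        IsAdicComplete (IsLocalRing.maximalIdeal R') R' ∧ HenselianLocalRing R' ∧
          IsAlgClosed (IsLocalRing.ResidueField R') ∧ Module.FaithfullyFlat R R' ∧
          (algebraMap R R').FaithfullyFlat ∧ Function.Injective (algebraMap R R') ∧
          (IsLocalRing.maximalIdeal R).map (algebraMap R R') = IsLocalRing.maximalIdeal R')
    {K : Type} [Field K] [NumberField K] (A : AbelianVariety K) (v : HeightOneSpectrum (𝓞 K))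
    (𝒳 : IntegralModel (valuationSubringAtPrime K v) K A.X) (h𝒳 : 𝒳.IsSmoothProper A.dim) :
    ∃ _ : GrpObj 𝒳.total, IsAbelianSchemeModel A v 𝒳.total := by
  -- the base `R = 𝓞_{K,v}`, a discrete valuation ring with fraction field `K`
  haveI : IsDiscreteValuationRing (valuationSubringAtPrime K v) :=
    IsLocalization.AtPrime.isDiscreteValuationRing_of_dedekind_domain (𝓞 K) v.ne_bot _
  -- the complete strictly local cover `R → R′` and the fraction field `K′` of `R′`
  obtain ⟨R', _, _, _, _, _, _, halg, -, hφ, hinj, -⟩ := h5 (valuationSubringAtPrime K v)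
  haveI : HenselianLocalRing R' := ‹_›
  haveI : IsAdicComplete (IsLocalRing.maximalIdeal R') R' := ‹_›
  let K' : Type := FractionRing R'
  -- `K → K′`: the map of fraction fields induced by the injective composite `R → R′ → K′ = Frac R′`
  -- (`K′` is an `R`-algebra through `R′`, Mathlib's `Localization` instance)
  have halgK' : algebraMap (valuationSubringAtPrime K v) K' =
      (algebraMap R' K').comp (algebraMap (valuationSubringAtPrime K v) R') :=
    IsScalarTower.algebraMap_eq (valuationSubringAtPrime K v) R' K'
  have hinj' : Function.Injective (algebraMap (valuationSubringAtPrime K v) K') := by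
    rw [halgK']
    exact (IsFractionRing.injective R' K').comp hinj
  let φK : K →+* K' := IsFractionRing.lift hinj'
  have hφK : ∀ x, φK (algebraMap (valuationSubringAtPrime K v) K x) =
      algebraMap (valuationSubringAtPrime K v) K' x :=
    fun x => IsFractionRing.lift_algebraMap hinj' x
  letI : Algebra K K' := φK.toAlgebra
  have hsq : (algebraMap R' K').comp (algebraMap (valuationSubringAtPrime K v) R') =
      φK.comp (algebraMap (valuationSubringAtPrime K v) K) := by
    rw [← halgK']
    exact RingHom.ext fun x => (hφK x).symm
  haveI : IsScalarTower (valuationSubringAtPrime K v) K K' :=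
    IsScalarTower.of_algebraMap_eq fun x => by
      rw [RingHom.algebraMap_toAlgebra]
      exact (hφK x).symm
  -- base change of the model along the cover: a smooth proper model of `A ⊗_K K′` over `R′` ...
  let 𝒳' : IntegralModel R' K' (A.baseChange K').X := 𝒳.baseChangeAbelianVariety R' K'
  have h𝒳' : 𝒳'.IsSmoothProper (A.baseChange K').dim := h𝒳.baseChangeAbelianVariety R' K'
  -- ... with geometrically irreducible fibres (§1 downstairs, stable under base change)
  haveI : GeometricallyIrreducible 𝒳.total.hom := 𝒳.geometricallyIrreducible_total_hom_abelianVariety h𝒳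
  haveI : GeometricallyIrreducible 𝒳'.total.hom := 𝒳.geometricallyIrreducible_baseChange_total R' K'
  -- Koizumi upstairs: an `R′`-group structure on `𝒳 ⊗ R′`
  obtain ⟨hG, -⟩ := hKSL R' halg K' (A.baseChange K') 𝒳' h𝒳'
  haveI : GrpObj ((Over.pullback (Spec.map (CommRingCat.ofHom
      (algebraMap (valuationSubringAtPrime K v) R')))).obj 𝒳.total) := hG
  -- Koizumi by descent (B-p05): `𝒳.total` is a Néron model of `A.X` over `𝓞_{K,v}` in the group-free sense
  haveI : SmoothOfRelativeDimension A.dim 𝒳.total.hom := h𝒳.1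
  haveI : IsProper 𝒳.total.hom := h𝒳.2
  haveI : Smooth 𝒳.total.hom := SmoothOfRelativeDimension.smooth A.dim _
  have hN : IsSchematicNeronModel (valuationSubringAtPrime K v) K 𝒳.total A.X :=
    isSchematicNeronModel_of_grpObj_baseChange (valuationSubringAtPrime K v) K R' K'
      (algebraMap _ R') hφ φK hsq 𝒳.total 𝒳.genericIso
  -- BLR 1.2/6 + 1.2/8: the group law of `A` extends to `𝒳.total`, an abelian-scheme model at `v`
  exact hN.exists_isAbelianSchemeModel A v ⟨𝒳, h𝒳⟩

/-- **Koizumi at number-field places from Koizumi over complete strictly local bases** — the junction head of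
`stub_W4_koizumi_descends` with the strictly-local cover consumed BY NAME
(★ `Literature.RingTheory.DiscreteValuationRing.exists_complete_dvr_faithfullyFlat_unramified_isAlgClosed`, the
closer of `stub_W5_strictlyLocalCover` in `r0_koizumi` v2): `stub_W4_koizumi_descends := fun hKSL _ =>
koizumi_of_koizumiStrictlyLocal hKSL`. [cite: Koizumi1960, Thm. p. 377]
[cite: BLRNeronModels1990, §1.2 Prop. 6, Prop. 8 and §6.5 Cor. 3] -/
theorem koizumi_of_koizumiStrictlyLocal
    (hKSL : ∀ (R' : Type) [CommRing R'] [IsDomain R'] [IsDiscreteValuationRing R'] [HenselianLocalRing R']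
      [IsAdicComplete (IsLocalRing.maximalIdeal R') R'], IsAlgClosed (IsLocalRing.ResidueField R') →
      ∀ (K' : Type) [Field K'] [Algebra R' K'] [IsFractionRing R' K'] (A' : AbelianVariety K')
        (𝒳' : IntegralModel R' K' A'.X) [GeometricallyIrreducible 𝒳'.total.hom], 𝒳'.IsSmoothProper A'.dim →
        ∃ _ : GrpObj 𝒳'.total, IsMonHom (M := (genericFibre R' K').obj 𝒳'.total) (N := A'.X) 𝒳'.genericIso.hom)
    {K : Type} [Field K] [NumberField K] (A : AbelianVariety K) (v : HeightOneSpectrum (𝓞 K))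
    (𝒳 : IntegralModel (valuationSubringAtPrime K v) K A.X) (h𝒳 : 𝒳.IsSmoothProper A.dim) :
    ∃ _ : GrpObj 𝒳.total, IsAbelianSchemeModel A v 𝒳.total :=
  koizumi_of_koizumiStrictlyLocal_of_strictlyLocalCover hKSL
    (fun R _ _ _ =>
      Literature.RingTheory.DiscreteValuationRing.exists_complete_dvr_faithfullyFlat_unramified_isAlgClosed R)
    A v 𝒳 h𝒳

end Literature.NumberTheory.DiophantineGeometry

end
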